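import Summits.ValiantsHypothesis.ValiantsHypothesis.Theorems.KPlusLogSqLawTridiagonalRealStaticWronskianLinksGauge
import Summits.ValiantsHypothesis.ValiantsHypothesis.Theorems.KPlusLogSqLawTridiagonalRealStaticPotentialCells

/-!
# Route «KPlusLogSqLaw», crux `WeakLifting` (stmt-ValiantsHypothesis-19561) — REAL side of the tridiagonal sector:
# the ROOT-GAP LAW — between two consecutive positive determinant zeros of a static symmetric tridiagonal design lies a zero of the previous
# continuant or a zero of the signed sum of squares (the gauged Christoffel–Darboux polynomial)

HONEST FRAMING.  Helper (`--supports stmt-ValiantsHypothesis-19561 --as helper`), seat val-sym-lift-p2 (g15), cell `pub-symmetroid`, 2026-08-28; α register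
(static definite symmetric tridiagonal row `B m`), UPPER / structure side; all sizes.  A REDUCTION, not a count: it says exactly which auxiliary zero
every gap between consecutive determinant zeros must contain.  Ingredients: the general-link Christoffel–Darboux identity of this seat
(`…WronskianLinksGauge.x_mul_derivative_mul_eval_of_root'`, p634007: at a root `x` of `D_{k+1}`, `x·D′_{k+1}(x)·D_k(x) = Σ_{j≤k} a_j(d_j − G_j)x^{d_j}Π_j D_j(x)²`
for every alternating antiderivative `G` of the doubled link exponents) and an elementary lemma on real polynomials typed here
(`derivative_eval_mul_nonpos_of_consecutive_roots`: at two CONSECUTIVE roots the derivative takes values of opposite sign or vanishes).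
THE LAW (`rootGap_law`, `exists_root_gaugedWronskian_of_consecutive_roots`): `0 < a_t`, links `b_t ≠ 0`; `0 < x₁ < x₂` roots of `D_{k+1}` with no root
of `D_{k+1}` strictly between and no root of `D_k` on `[x₁, x₂]`.  Then the signed sums of squares at the two roots have product `≤ 0`, so the GAUGED
WRONSKIAN `Ω_G = X·(D′_{k+1}D_k − D_{k+1}D′_k) − G_k·D_kD_{k+1}` (a polynomial; `=` the signed sum of squares `Σ_j a_j(d_j − G_j)X^{d_j}Π_jD_j²` by p634007) has a
zero on `[x₁, x₂]` — for EVERY gauge constant `G 0`.  READING (the cell's particle bookkeeping, seat memo ROOT-TYPE-CALCULUS §6): consecutive roots of `D_m`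
with no root of `D_{m−1}` between are of OPPOSITE TYPE (creation/annihilation), and the type-deciding polynomial `Ω_G` must vanish between them; hence
`Z(D_m) ≤ 1 + #{zeros of D_{m−1}·Ω_G meeting the gaps}` — the α law «B m ≤ 2m − 3» is EQUIVALENT to a linear budget for the positive zeros of the
`(m+1)`-term signed sums of squares `Ω_G` net of those of `D_{m−1}`; on the register's breathing extremal designs (located) `D_{m−1}` has ≤ 2 zeros and `Ω_G`
carries all `Z − 1` gaps.  Nothing here bears on `WeakLifting` / `TropicalB` (stmt-19771) in their windows, on Conjecture B, on the Door-A registers, on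
`MatrixDescartes` (stmt-18050) or on VP ≠ VNP.
[folklore: Rolle / factor theorem; bookkeeping of this seat]
-/

set_option linter.dupNamespace false
set_option autoImplicit false

namespace Summit.ValiantsHypothesis.ValiantsHypothesis.Theorems.KPlusLogSqLaw

namespace StaticTridiagonalRealPotential

open Polynomial Finset

/-! ## 1. Real polynomials: the derivative alternates (weakly) at consecutive roots -/

/-- **At two consecutive roots of a non-zero real polynomial the derivative values have product `≤ 0`.**  (`P = (X − x₁)(X − x₂)Q` with `Q` of one sign on
`[x₁, x₂]` by the intermediate value theorem; `P′(x₁) = (x₁ − x₂)Q(x₁)`, `P′(x₂) = (x₂ − x₁)Q(x₂)`.) [folklore] -/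
theorem derivative_eval_mul_nonpos_of_consecutive_roots (P : ℝ[X]) {x₁ x₂ : ℝ} (hlt : x₁ < x₂)
    (h₁ : P.eval x₁ = 0) (h₂ : P.eval x₂ = 0) (hno : ∀ y, x₁ < y → y < x₂ → P.eval y ≠ 0) :
    (derivative P).eval x₁ * (derivative P).eval x₂ ≤ 0 := by
  -- factor out the two roots
  have hr₁ : P.IsRoot x₁ := h₁
  obtain ⟨P₁, hP₁⟩ : (X - C x₁) ∣ P := dvd_iff_isRoot.mpr hr₁
  have hP₁x₂ : P₁.eval x₂ = 0 := by
    have := h₂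
    rw [hP₁, eval_mul, eval_sub, eval_X, eval_C] at this
    rcases mul_eq_zero.mp this with h | h
    · exact absurd (sub_eq_zero.mp h) (ne_of_gt hlt)
    · exact h
  obtain ⟨Q, hQ⟩ : (X - C x₂) ∣ P₁ := dvd_iff_isRoot.mpr hP₁x₂
  -- the derivative at the two roots
  have hd : derivative P = P₁ + (X - C x₁) * derivative P₁ := by
    rw [hP₁, derivative_mul, derivative_sub, derivative_X, derivative_C, sub_zero, one_mul]
  have hdP₁ : derivative P₁ = Q + (X - C x₂) * derivative Q := by
    rw [hQ, derivative_mul, derivative_sub, derivative_X, derivative_C, sub_zero, one_mul]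
  have e₁ : (derivative P).eval x₁ = (x₁ - x₂) * Q.eval x₁ := by
    rw [hd, eval_add, eval_mul, eval_sub, eval_X, eval_C, sub_self, zero_mul, add_zero, hQ, eval_mul, eval_sub, eval_X, eval_C]
  have e₂ : (derivative P).eval x₂ = (x₂ - x₁) * Q.eval x₂ := by
    rw [hd, eval_add, hP₁x₂, zero_add, eval_mul, eval_sub, eval_X, eval_C, hdP₁, eval_add, eval_mul, eval_sub, eval_X, eval_C,
      sub_self, zero_mul, add_zero]
  -- `Q` does not change sign on `[x₁, x₂]`: a sign change would give a root of `Q`, hence of `P`, strictly between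
  have hQsign : 0 ≤ Q.eval x₁ * Q.eval x₂ := by
    by_contra hneg
    rw [not_le] at hneg
    have hcont : ContinuousOn (fun y => Q.eval y) (Set.Icc x₁ x₂) := Q.continuous.continuousOn
    rcases mul_neg_iff.mp hneg with ⟨hq₁, hq₂⟩ | ⟨hq₁, hq₂⟩
    · obtain ⟨y, ⟨hy₁, hy₂⟩, hy⟩ := intermediate_value_Ioo' hlt.le hcont ⟨hq₂, hq₁⟩
      refine hno y hy₁ hy₂ ?_
      rw [hP₁, hQ, eval_mul, eval_mul]
      rw [show (fun y => eval y Q) y = Q.eval y from rfl] at hy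
      rw [hy, mul_zero, mul_zero]
    · obtain ⟨y, ⟨hy₁, hy₂⟩, hy⟩ := intermediate_value_Ioo hlt.le hcont ⟨hq₁, hq₂⟩
      refine hno y hy₁ hy₂ ?_
      rw [hP₁, hQ, eval_mul, eval_mul]
      rw [show (fun y => eval y Q) y = Q.eval y from rfl] at hy
      rw [hy, mul_zero, mul_zero]
  rw [e₁, e₂]
  have hsq : 0 ≤ (x₂ - x₁) ^ 2 := sq_nonneg _
  nlinarith [mul_nonneg hsq hQsign]

/-- **A non-vanishing polynomial keeps its sign on an interval**: `Q ≠ 0` on `[x₁, x₂]` ⇒ `Q(x₁)·Q(x₂) > 0`. [folklore: intermediate values] -/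
theorem eval_mul_eval_pos_of_noRoot_Icc (Q : ℝ[X]) {x₁ x₂ : ℝ} (hle : x₁ ≤ x₂) (hno : ∀ y, x₁ ≤ y → y ≤ x₂ → Q.eval y ≠ 0) :
    0 < Q.eval x₁ * Q.eval x₂ := by
  have hq₁ : Q.eval x₁ ≠ 0 := hno x₁ le_rfl hle
  have hq₂ : Q.eval x₂ ≠ 0 := hno x₂ hle le_rfl
  rcases lt_trichotomy (Q.eval x₁ * Q.eval x₂) 0 with hneg | h0 | hpos
  · exfalso
    have hcont : ContinuousOn (fun y => Q.eval y) (Set.Icc x₁ x₂) := Q.continuous.continuousOn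
    rcases mul_neg_iff.mp hneg with ⟨hp, hn⟩ | ⟨hn, hp⟩
    · obtain ⟨y, ⟨hy₁, hy₂⟩, hy⟩ := intermediate_value_Icc' hle hcont ⟨hn.le, hp.le⟩
      exact hno y hy₁ hy₂ hy
    · obtain ⟨y, ⟨hy₁, hy₂⟩, hy⟩ := intermediate_value_Icc hle hcont ⟨hn.le, hp.le⟩
      exact hno y hy₁ hy₂ hy
  · exact absurd h0 (mul_ne_zero hq₁ hq₂)
  · exact hpos

/-! ## 2. The root-gap law of the α register -/

variable (a : ℕ → ℝ) (d : ℕ → ℕ) (b : ℕ → ℝ) (f : ℕ → ℕ)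

/-- **ROOT-GAP LAW (sign form).**  Consecutive positive roots `x₁ < x₂` of `D_{k+1}` (no root of `D_{k+1}` strictly between) with no root of `D_k` on
`[x₁, x₂]`: the signed sums of squares `Σ_{j≤k} a_j(d_j − G_j)x^{d_j}(∏_{j≤i<k}(b_ix^{f_i})²)D_j(x)²` at `x = x₁` and at `x = x₂` have product `≤ 0` — the two
roots are of opposite type or one of them is multiple — for EVERY alternating antiderivative `G` of the doubled link exponents. [bookkeeping of this seat] -/
theorem rootGap_law (G : ℕ → ℤ) (hG : ∀ j, G (j + 1) = 2 * (f j : ℤ) - G j) (k : ℕ)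
    {x₁ x₂ : ℝ} (hx₁ : 0 < x₁) (hlt : x₁ < x₂)
    (h₁ : (pathDet a d b f (k + 1)).eval x₁ = 0) (h₂ : (pathDet a d b f (k + 1)).eval x₂ = 0)
    (hno : ∀ y, x₁ < y → y < x₂ → (pathDet a d b f (k + 1)).eval y ≠ 0)
    (hk : ∀ y, x₁ ≤ y → y ≤ x₂ → (pathDet a d b f k).eval y ≠ 0) :
    (∑ j ∈ range (k + 1), (a j * ((d j : ℝ) - (G j : ℝ))) * x₁ ^ d j *
        (∏ i ∈ Ico j k, (b i * x₁ ^ f i) ^ 2) * ((pathDet a d b f j).eval x₁) ^ 2) *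
      (∑ j ∈ range (k + 1), (a j * ((d j : ℝ) - (G j : ℝ))) * x₂ ^ d j *
        (∏ i ∈ Ico j k, (b i * x₂ ^ f i) ^ 2) * ((pathDet a d b f j).eval x₂) ^ 2) ≤ 0 := by
  rw [← x_mul_derivative_mul_eval_of_root' a d b f G hG k h₁, ← x_mul_derivative_mul_eval_of_root' a d b f G hG k h₂]
  have hD := derivative_eval_mul_nonpos_of_consecutive_roots (pathDet a d b f (k + 1)) hlt h₁ h₂ hno
  have hK := eval_mul_eval_pos_of_noRoot_Icc (pathDet a d b f k) hlt.le hk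
  have hx₂ : 0 < x₂ := hx₁.trans hlt
  have : x₁ * ((derivative (pathDet a d b f (k + 1))).eval x₁ * (pathDet a d b f k).eval x₁) *
      (x₂ * ((derivative (pathDet a d b f (k + 1))).eval x₂ * (pathDet a d b f k).eval x₂)) =
      (x₁ * x₂) * ((derivative (pathDet a d b f (k + 1))).eval x₁ * (derivative (pathDet a d b f (k + 1))).eval x₂) *
        ((pathDet a d b f k).eval x₁ * (pathDet a d b f k).eval x₂) := by ring
  rw [this]
  exact mul_nonpos_of_nonpos_of_nonneg (mul_nonpos_of_nonneg_of_nonpos (mul_pos hx₁ hx₂).le hD) hK.le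

/-- **ROOT-GAP LAW (zero form).**  Under the hypotheses of `rootGap_law` the GAUGED WRONSKIAN polynomial
`Ω_G = X·(D′_{k+1}D_k − D_{k+1}D′_k) − C(G_k)·D_kD_{k+1}` — equal to the signed sum of squares `Σ_j a_j(d_j − G_j)X^{d_j}Π_jD_j²` by
`X_mul_wronskian_eq_sum_links'` — has a zero on `[x₁, x₂]`, for EVERY gauge constant.  So every gap between consecutive positive zeros of `D_{k+1}`
contains a zero of `D_k` or of `Ω_G`. [bookkeeping of this seat] -/
theorem exists_root_gaugedWronskian_of_consecutive_roots (G : ℕ → ℤ) (hG : ∀ j, G (j + 1) = 2 * (f j : ℤ) - G j) (k : ℕ)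
    {x₁ x₂ : ℝ} (hx₁ : 0 < x₁) (hlt : x₁ < x₂)
    (h₁ : (pathDet a d b f (k + 1)).eval x₁ = 0) (h₂ : (pathDet a d b f (k + 1)).eval x₂ = 0)
    (hno : ∀ y, x₁ < y → y < x₂ → (pathDet a d b f (k + 1)).eval y ≠ 0)
    (hk : ∀ y, x₁ ≤ y → y ≤ x₂ → (pathDet a d b f k).eval y ≠ 0) :
    ∃ y ∈ Set.Icc x₁ x₂,
      ((X : ℝ[X]) * (derivative (pathDet a d b f (k + 1)) * pathDet a d b f k
          - pathDet a d b f (k + 1) * derivative (pathDet a d b f k))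
        - C ((G k : ℝ)) * pathDet a d b f k * pathDet a d b f (k + 1)).eval y = 0 := by
  set Ω : ℝ[X] := (X : ℝ[X]) * (derivative (pathDet a d b f (k + 1)) * pathDet a d b f k
      - pathDet a d b f (k + 1) * derivative (pathDet a d b f k)) - C ((G k : ℝ)) * pathDet a d b f k * pathDet a d b f (k + 1) with hΩ
  -- at the two roots `Ω` is `x·D′_{k+1}·D_k`
  have hΩroot : ∀ x, (pathDet a d b f (k + 1)).eval x = 0 →
      Ω.eval x = x * ((derivative (pathDet a d b f (k + 1))).eval x * (pathDet a d b f k).eval x) := by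
    intro x hx
    simp only [hΩ, eval_sub, eval_mul, eval_X, eval_C, hx, zero_mul, mul_zero, sub_zero]
  have hprod : Ω.eval x₁ * Ω.eval x₂ ≤ 0 := by
    rw [hΩroot x₁ h₁, hΩroot x₂ h₂, x_mul_derivative_mul_eval_of_root' a d b f G hG k h₁,
      x_mul_derivative_mul_eval_of_root' a d b f G hG k h₂]
    exact rootGap_law a d b f G hG k hx₁ hlt h₁ h₂ hno hk
  -- intermediate values
  have hcont : ContinuousOn (fun y => Ω.eval y) (Set.Icc x₁ x₂) := Ω.continuous.continuousOn
  rcases le_or_gt (Ω.eval x₁) 0 with hle | hgt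
  · rcases le_or_gt 0 (Ω.eval x₂) with hle' | hgt'
    · obtain ⟨y, hy, hy0⟩ := intermediate_value_Icc hlt.le hcont ⟨hle, hle'⟩
      exact ⟨y, hy, hy0⟩
    · -- both `≤ 0`/`< 0`: the product is `≥ 0`, so with `≤ 0` one factor vanishes
      have h0 : Ω.eval x₁ = 0 := by nlinarith
      exact ⟨x₁, ⟨le_rfl, hlt.le⟩, h0⟩
  · rcases le_or_gt (Ω.eval x₂) 0 with hle' | hgt'
    · obtain ⟨y, hy, hy0⟩ := intermediate_value_Icc' hlt.le hcont ⟨hle', hgt.le⟩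
      exact ⟨y, hy, hy0⟩
    · exfalso
      have := mul_pos hgt hgt'
      linarith

end StaticTridiagonalRealPotential

end Summit.ValiantsHypothesis.ValiantsHypothesis.Theorems.KPlusLogSqLaw
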